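import Literature.MathematicalPhysics.QuantumFieldTheory.Balaban1983to89.B1LowerBound

/-!
# `Balaban1983to89.B1Sect3Statements` — B1 Sect. 3 (pp. 612–625): the displays of *"Formal Properties of the
Renormalization Procedure"* that the sequels cite BY NUMBER and that the sibling `…B1LowerBound` does not carry —
(3.8)–(3.9)/(3.12)/(3.43) the unit-lattice and fluctuation restrictions, (3.7) the rescaled first-step action,
(3.10)/(3.18)/(3.41)/(3.48) the translations and (3.11) the completed square, (3.14) the Taylor split of `U(A) =
exp(ηqe(L^kε)A)` with its integral remainder `R_{n̄+1}` and the p. 615 bound `|R_{n̄+1}(qA)| ≤ 1` (PROVED), (3.23)–(3.24)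
the truncated cumulants, (3.30) the form of the action, (3.34) the composite contour field, (3.36)/(3.62)/(3.65) the
perturbative formula, p. 614/(3.54) the conditions on `b₀, b₁, p, p₁`, (3.56) the fluctuation integral, (3.68)–(3.69) the
last step — as typed statement-level leaves; and KERNEL PROOFS of the two determinant inequalities (3.47) (matrix form,
the predicate `B1LowerBound.Ineq347`) and (3.69) from the spectral theorem

statement-level skeleton of published theorems with citation tags; proofs where landed; nothing here is a claim about
the Yang–Mills mass gap.

CITATION HEADER (lean-in-tree rule 2026-08-18).  T. Bałaban, *(Higgs)₂,₃ quantum fields in a finite volume. I. A lower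
bound*, Commun. Math. Phys. **85**, 603–626 (1982), doi:10.1007/bf01403506, bib `Balaban1982Higgs1` (cell paper B1; PDF
held `paper:balaban1982-cmp85-higgs23-i`, journal page = PDF page + 602).  Every quotation below was READ AS AN IMAGE on
the x2 renders `run/shared/lean/pub/pub-balaban/b2b-balaban-ref1/pages/1982-cmp85-higgs23-I/…-p011…p023-x2.png`, not on
the OCR layer.  NOTHING printed is asserted here as a fact: every display enters as a PARAMETERISED definition
(`def … : Prop`, or an `ℝ`/`ℂ`-valued expression) whose docstring quotes it with its page; the `theorem`s are elementary
(definitional unfoldings, the algebra of truncated expectations, the p. 615 bound `|R_{n̄+1}(iy)| ≤ 1` on the Taylor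
remainder (3.14) as a norm estimate of an interval integral, the determinant inequalities (3.47)/(3.69) for real
symmetric matrices via Mathlib's spectral theorem, the final inference of p. 625), proved without `sorry`/new axioms.

WHY THIS MODULE (mega-formalization `lit-balaban`, reader r12 as second reader of B1 = "Part 2" of the B1 rows; the
numbered statements Thm p. 606, Props 3.1/3.2 and Sects. 1–2 are reader r01's).  Which Sect. 3 displays the sequels
cite by number (grep of the held texts): [Balaban1982Higgs2] (= II) cites (I.3.7), (I.3.10), (I.3.14)–(I.3.16),
(I.3.27)–(I.3.29), (I.3.44), (I.3.45), (I.3.56), (I.3.59) and "Proposition I.3.1"; [Balaban1983Higgs3] (= III) cites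
(I.3.14), (I.3.34), (I.3.44), (I.3.45); [Balaban1983RegularityDecay] p. 590 cites (I.3.15), (I.3.44).  Of these,
(3.15), (3.16), (3.44), (3.45) are ALREADY kernel-checked in the sibling `…Balaban1983to89.B1` (`B1.blockAvg`,
`B1.display315`, `B1.display316`, `B1.resolvent_of_diff`, `B1.display344_of_316`, `B1.display345_of_344`) and are
NOT restated here.  RELATION TO `…Balaban1983to89.B1LowerBound` (reader r14, imported): that module carries the
Theorem (1.14)/(1.15) (`B1LowerBound.ThmPrinted`, `Ext115Printed`), the small-field restriction (3.1)–(3.2)/(3.4)–(3.5)/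
(3.27)–(3.28) (`B1LowerBound.SmallFieldAt`, `ChiK`, with `B2.pFn` = the threshold function p(ε) = b₀(1 + log ε⁻¹)^p of
(3.1)/(3.12)), the background field (3.3)/(3.29) (`B1LowerBound.bgField`), the induction hypothesis (3.26)
(`B1LowerBound.IndHyp326`), Props. 3.1/3.2 (`Prop31Printed`, `Prop32Printed`), the cumulant expansion (3.59) over a run
(`Cumulant359`), the logarithm inequality of p. 620 PROVED for all odd n (`log_one_add_le_logTaylor`) and (3.47) TYPED
(`B1LowerBound.Ineq347`) — none of these is restated here; this module REUSES them (`B2.pFn` in the conditions p. 614/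
(3.54), `B1LowerBound.SmallFieldAt` in `smallFieldUnit_iff`, `B1LowerBound.Ineq347`/`ineq347_scalar` in the matrix proof
`ineq347_of_posDef`) and types the rest.  Conventions: lattice sites are abstract finite types (`X` ↤ the unit
lattice `T₁`/`T₁^{(k)}` of fine fields, `Y` ↤ the block lattice `T′₁`/`T_L^{(k+1)}`), field values live in a real
inner product space `W` (↤ `R^N` for `φ, ψ`, `R^d`-components for `A, B`), operators the paper defines elsewhere
(`Q`, `Q(A)`, `−Δ`, `−Δ_A`, `C^{(0)}`, `G_k`, `Q_k^*`) are explicit arguments, "sizes" `|A(x)|`, `|(ΔA)(x)|` are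
real-valued functions, `O(1)`/`O(ε^κ)` constants are explicit parameters — the schematic style of the B-family
(cell DIVERGENCE D-b01.3).  Companion rows: `run/shared/lean/pub/lit-balaban/lit-balaban-r12/ROWS-B1-part2.md`.

v1.1 (unit `lit-balaban-r12` gen 27) — Part G, APPEND-ONLY (every v1.0 declaration byte-identical): the ONE-SIDED
READING IN `λ′` of the perturbative sums (3.36)/(3.62)/(3.63).  LOCATED DEFECT OF THE v1.0 TYPING (the *"latent same
pattern"* of typer g24's semantic audit `B1Eq113OneSidedDerivatives`, p330976, repaired for (1.13) by r01's
`B1Sect1Statements.ModelData.e1R`, p331274): `pertSum362` takes the `λ′`-derivatives of the generating function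
TWO-SIDEDLY at `λ′ = 0` (`iteratedDeriv β · 0`), but the lattice generating functions `E_k(e′, λ′, ·, ·)` of (3.35) are
`−log` of Gaussian-times-`exp(−λ′Σ|φ|⁴ …)` integrals that exist ONLY for `λ′ ≥ 0` (*"we will assume that μ₀² > 0 and
λ > 0"*, p. 605; for `λ′ < 0` the quartic wins and, with Lean's total conventions, the function is junk there), so at a
concrete model the two-sided `β ≥ 1` coefficients are not the printed Taylor coefficients of the perturbation series.
WHAT THE PRINT DENOTES by `∂^{α+β}/∂e′^α∂λ′^β E(e′, λ′, B, ψ)|_{e′=λ′=0}` is the coefficient of the perturbation expansion,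
i.e. the RIGHT derivative in `λ′` at `0⁺`.  DECLS OF RECORD for instantiation at lattice generating functions (new
names, suffix `R` as in r01's repair): **`pertSum362R`** — (3.62)/(3.36) with `iteratedDerivWithin β · (Set.Ici 0) 0` in
`λ′` (inner) and `iteratedDeriv α · 0` in `e′` (outer) —, **`Eq336R`**, **`Step363R`**; with the kernel facts that make the
repair honest and cheap: `pertSum362R_congr_Ici` (the R-sum depends on `E` only through its values on `λ′ ≥ 0`),
`pertSum362R_eq_pertSum362` (for `E` that IS `C^{n̄}` in `λ′` at `0` two-sidedly the two readings agree — so every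
schematic theorem about `pertSum362` under two-sided smoothness hypotheses, e.g. p14's (3.62) ⇒ (3.63) ⇒ (3.36)_{k+1}
chain `B1Eq363JetProof`/`B1Eq364Substitution`/`B1Step363Proof`, transfers verbatim), and the one-sided twins of the
(3.65) ⇒ (3.63) ⇔ (3.36)_{k+1} algebra (`pertSum362R_const_add`, `step363R_of_eq365`, `eq336R_succ`, `step363R_iff`,
`pertSum362R_zero`; re-proved here, not imported from p14's `B1Step363Proof` — that module imports this one).  The v1.0
`pertSum362`/`Eq336`/`Step363` are kept for their importers.  HONEST SCOPE: a convention is fixed (inner `λ′` from the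
right, outer `e′` two-sided), equal to the printed mixed partial for a function jointly smooth on `ℝ × [0, ∞)` near
`(0, 0)`; joint smoothness of the lattice `E_k` is NOT asserted here (it is the differentiability bookkeeping of
(3.61)–(3.65), hypotheses of p14's files); nothing printed is refuted — the defect was in our v1.0 reading only.
-/

open scoped BigOperators
open Finset MeasureTheory

namespace Literature.MathematicalPhysics.QuantumFieldTheory.Balaban1983to89.B1Sect3Statements

/-! ## Part A. The unit-lattice and fluctuation restrictions (3.8)–(3.9), (3.12), (3.20), (3.43), (3.50); the conditions
p. 614 and (3.54) on the thresholds `p(·) = B2.pFn b₀ p ·`, `p₁(·) = B2.pFn b₁ p₁ ·` -/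

section Thresholds

/-- **(3.8)–(3.9)** p. 613, verbatim: *"|A(x)| ≦ p(ε), |(ΔA)(x)| ≦ p(ε), (3.8)  |φ(x)| ≦ p(ε), |(Δ_Aφ)(x)| ≦ p(ε),
x∈T₁, (3.9)"* — the restrictions (3.1)–(3.2) after the rescaling to the unit lattice (`ℓ = 1` in `B1LowerBound.SmallFieldAt`).
[cite: Balaban1982Higgs1, (3.8)–(3.9) p.613] -/
def SmallFieldUnit (pε : ℝ) {X : Type*} (absF absLapF : X → ℝ) : Prop := ∀ x, absF x ≤ pε ∧ absLapF x ≤ pε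

/-- (3.8)–(3.9) is the restriction (3.1)–(3.2) (`B1LowerBound.SmallFieldAt`, pointwise) at spacing `1`, at every point
(definitional: `1 ^ (−(d∓2)/2) = 1`). [cite: Balaban1982Higgs1, (3.8)–(3.9) p.613] -/
theorem smallFieldUnit_iff (d : ℕ) (pε : ℝ) {X : Type*} (absF absLapF : X → ℝ) :
    SmallFieldUnit pε absF absLapF ↔ ∀ x, B1LowerBound.SmallFieldAt d 1 pε (absF x) (absLapF x) := by
  simp [B1LowerBound.SmallFieldAt, SmallFieldUnit, Real.one_rpow]

/-- **(3.12)** p. 614, **(3.20)** p. 615, **(3.43)** p. 619, **(3.50)** p. 621, verbatim (3.43): *"χ(A′) = Π_{x∈T₁^{(k)}}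
χ({|A′(x)| ≦ p₁(L^kε)})"* (and the same for `φ′`): the fluctuation-field restriction at threshold `p1s = p₁(L^kε)`.
[cite: Balaban1982Higgs1, (3.43) p.619] -/
def SmallFluct (p1s : ℝ) {X : Type*} (absF' : X → ℝ) : Prop := ∀ x, absF' x ≤ p1s

/-- p. 614 [PDF 12], verbatim: *"Now we will demand that the restrictions on A′ introduced by the above characteristic
functions and the restrictions on B^{(1)} introduced by the functions χ₁(B) imply the restrictions (3.8). To meet the
demand it is sufficient to require 4dp₁(ε) + p(Lε) ≦ p(ε). For example it is easy to see that this condition is satisfied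
if p − 1 ≧ p₁, b₀p log L ≧ 4db₁(1 + log L)^{p₁}."* — the requirement and the equality (3.13)/(3.21) it yields are the
first instance of the general conditions (3.54); `p(·) = B2.pFn b₀ p ·` ((3.1) p. 613), `p₁(·) = B2.pFn b₁ p₁ ·` ((3.12)
p. 614: *"p₁(ε) = b₁(1 + log ε⁻¹)^{p₁}"*). [cite: Balaban1982Higgs1, (3.13) p.614] -/
def Demand313 (d b₀ p b₁ p₁ L ε : ℝ) : Prop :=
  4 * d * B2.pFn b₁ p₁ ε + B2.pFn b₀ p (L * ε) ≤ B2.pFn b₀ p ε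

/-- **(3.54)** p. 622 [PDF 20], verbatim: *"if c₁p₁(L^kε) + p(L^{k+1}ε) + c₂(L^kε)^α ≦ p(L^kε), and this inequality is
satisfied if e.g. p − 1 ≧ p₁, b₀p log L ≧ c₁b₁(1 + log L)^{p₁}, ½b₀p(p − 1) log L ≧ c₂(L^kε)^α, (3.54) where we
have assumed L^{k+1}ε ≦ 1. In the sequel we will assume that the conditions (3.54) are satisfied. Let us notice that the
first two can be satisfied by a proper choice of b₀, b₁, p, p₁, but the third demands additionally L^kε ≦ ε₀ for
sufficiently small ε₀."* (`s = L^kε`; `c₁, c₂, α` the constants of p. 622 ll. 1–4). [cite: Balaban1982Higgs1, (3.54) p.622] -/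
def Cond354 (b₀ p b₁ p₁ L c₁ c₂ α s : ℝ) : Prop :=
  p₁ ≤ p - 1 ∧ c₁ * b₁ * (1 + Real.log L) ^ p₁ ≤ b₀ * p * Real.log L ∧
    c₂ * s ^ α ≤ 1 / 2 * b₀ * p * (p - 1) * Real.log L

/-- (3.54), the inequality it serves, verbatim: *"c₁p₁(L^kε) + p(L^{k+1}ε) + c₂(L^kε)^α ≦ p(L^kε)"* (`s = L^kε`).
[cite: Balaban1982Higgs1, (3.54) p.622] -/
def Ineq354 (b₀ p b₁ p₁ L c₁ c₂ α s : ℝ) : Prop :=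
  c₁ * B2.pFn b₁ p₁ s + B2.pFn b₀ p (L * s) + c₂ * s ^ α ≤ B2.pFn b₀ p s

end Thresholds

/-! ## Part B. The rescaled first-step action (3.7) and the translations (3.10), (3.18), (3.41), (3.48) -/

section Actions

variable {X Y W : Type*} [Fintype X] [Fintype Y] [NormedAddCommGroup W] [InnerProductSpace ℝ W]

/-- **(3.7)** p. 613 [PDF 11], the exponent of the first-step integral after the rescaling to the unit lattice, verbatim:
*"const ∫dA∫dφ χ₀(A)χ₀(φ) exp[−½aL^{d−2} Σ_{y∈T′₁} |B(y) − (QA)(y)|² − ½⟨A, (−Δ + μ₀²ε²)A⟩ − ½aL^{d−2} Σ_{y∈T′₁}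
|ψ(y) − (Q(A)φ)(y)|² − ½⟨φ, (−Δ_A + m²ε²)φ⟩ − ½δm²ε² Σ_{x∈T₁} |φ(x)|² − λε^{4−d} Σ_{x∈T₁} |φ(x)|⁴ − E]"* —
typed as MINUS the exponent (the rescaled action), with the block averagings `Q`, `QA` (= `Q(A)`, `B1.blockAvg`) and
the two quadratic forms `formA A = ⟨A, (−Δ + μ₀²ε²)A⟩`, `formφ φ = ⟨φ, (−Δ_A + m²ε²)φ⟩` as explicit arguments.
[cite: Balaban1982Higgs1, (3.7) p.613] -/
noncomputable def action37 (a L d δm2 ε lam E : ℝ) (Q QA : (X → W) → (Y → W))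
    (formA formφ : (X → W) → ℝ) (A φ : X → W) (B ψ : Y → W) : ℝ :=
  1 / 2 * a * L ^ (d - 2) * (∑ y, ‖B y - Q A y‖ ^ 2) + 1 / 2 * formA A
    + 1 / 2 * a * L ^ (d - 2) * (∑ y, ‖ψ y - QA φ y‖ ^ 2) + 1 / 2 * formφ φ
    + 1 / 2 * δm2 * ε ^ 2 * (∑ x, ‖φ x‖ ^ 2) + lam * ε ^ (4 - d) * (∑ x, ‖φ x‖ ^ 4) + E

omit [Fintype X] [Fintype Y] in
/-- **(3.10)** p. 614 [PDF 12], verbatim: *"A = A′ + aL⁻²C^{(0)}Q*B =: A′ + B^{(1)}"*; the same shape is **(3.18)** p. 615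
(*"φ = φ′ + aL⁻²C^{(0)}(B^{(1)})Q*(B^{(1)})ψ =: φ′ + ψ^{(1)}"*), **(3.41)** p. 619 (*"A = A′ + aL⁻²C^{(k)}Q*B"*) and
**(3.48)** p. 621 (*"φ = φ′ + aL⁻²C^{(k)}(B^{(k+1)})Q*(B^{(k+1)})ψ"*): translation of the integration variable by the
minimiser `c • C (Qstar B)` (`c = aL⁻²`, `C` the covariance, `Qstar` the adjoint averaging). [cite: Balaban1982Higgs1, (3.10) p.614] -/
def transl310 {V U : Type*} [AddCommGroup V] [Module ℝ V] [AddCommGroup U] [Module ℝ U]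
    (c : ℝ) (C : V →ₗ[ℝ] V) (Qstar : U →ₗ[ℝ] V) (A' : V) (B : U) : V :=
  A' + c • C (Qstar B)

omit [Fintype X] [Fintype Y] in
/-- **(3.11)** p. 614, verbatim: *"separating the quadratic form in the fields A, B in (3.7) into a sum of two forms
½⟨B, Δ^{(1),L}B⟩ + ½(aL^{d−2} Σ_{y∈T′₁} |(QA′)(y)|² + ⟨A′, (−Δ + μ₀²ε²)A′⟩) = ½⟨B, Δ^{(1),L}B⟩ + ½⟨A′, (C^{(0)})⁻¹A′⟩"*
(and **(3.19)** p. 615 for the scalar fields) — the completing-of-the-square identity, typed as a `Prop` over the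
quadratic forms involved (`qAB` = the left form of (3.7) in `A, B`, `qB` = `½⟨B, Δ^{(1),L}B⟩`, `qA'` =
`½⟨A′, (C^{(0)})⁻¹A′⟩`) and the translation (3.10). [cite: Balaban1982Higgs1, (3.11) p.614] -/
def Split311 {V U : Type*} [AddCommGroup V] [Module ℝ V] [AddCommGroup U] [Module ℝ U]
    (c : ℝ) (C : V →ₗ[ℝ] V) (Qstar : U →ₗ[ℝ] V) (qAB : V → U → ℝ) (qB : U → ℝ) (qA' : V → ℝ) : Prop :=
  ∀ A' B, qAB (transl310 c C Qstar A' B) B = qB B + qA' A'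

end Actions

/-! ## Part C. (3.14): the Taylor split of `U(A) = exp(ηqe(L^kε)A)` and the remainder `R_{n̄+1}` -/

section Taylor

/-- **(3.14)** p. 614 [PDF 12], the remainder, verbatim: *"R_{n̄+1}(z) is an analytic function of z defined by the formula
R_{n̄+1}(z) = (n̄ + 1)∫₀¹ (1 − t)^{n̄} e^{tz} dt"* (here `n = n̄`). [cite: Balaban1982Higgs1, (3.14) p.614] -/
noncomputable def taylorRem (n : ℕ) (z : ℂ) : ℂ :=
  (n + 1) * ∫ t in (0 : ℝ)..1, ((1 - t : ℝ) : ℂ) ^ n * Complex.exp (t * z)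

/-- **(3.14)** p. 614, verbatim: *"U(A) = exp(ηqe(L^kε)A) = 1 + Σ_{n=1}^{n̄} (ηqe(L^kε)A)ⁿ/n! +
(ηqe(L^kε)A)^{n̄+1}/(n̄+1)! R_{n̄+1}(ηqe(L^kε)A) =: 1 + ηF_{1,k}(A) =: 1 + F′_{1,k}(A), where e(L^kε) = e(L^kε)^{(4−d)/2}"*
[sic: `e(L^kε) = e·(L^kε)^{(4−d)/2}`].  The Taylor identity for `exp` with the integral remainder, at the (complex)
argument `z = ηqe(L^kε)A` (one matrix entry / one abelian component), typed as a `Prop` of `n̄` and `z`.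
[cite: Balaban1982Higgs1, (3.14) p.614] -/
def Eq314 (nbar : ℕ) (z : ℂ) : Prop :=
  Complex.exp z = ∑ n ∈ Finset.range (nbar + 1), z ^ n / (n.factorial : ℂ)
    + z ^ (nbar + 1) / ((nbar + 1).factorial : ℂ) * taylorRem nbar z

/-- **(3.14)**, the definition `F′_{1,k}(A) := U(A) − 1 = ηF_{1,k}(A)` (as used in (3.15)/(3.16), `B1.display315`'s
hypothesis `h314`). [cite: Balaban1982Higgs1, (3.14) p.614] -/
noncomputable def F1prime (z : ℂ) : ℂ := Complex.exp z - 1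

/-- `U = 1 + F′_{1,k}` (definitional). [cite: Balaban1982Higgs1, (3.14) p.614] -/
theorem exp_eq_one_add_F1prime (z : ℂ) : Complex.exp z = 1 + F1prime z := by
  simp [F1prime]

/-- p. 615 [PDF 13], verbatim: *"Further we can estimate the terms containing the matrix R_{n̄+1}(·) using the inequality
|R_{n̄+1}(qA)| ≦ 1, which holds for arbitrary real A"* (`q` purely imaginary: `U(A) = exp(iεeA)` is unitary) — typed
for the argument `z = iy`, `y` real. [cite: Balaban1982Higgs1, p.615 (bound on R_{n̄+1})] -/
def RemBound (n : ℕ) (y : ℝ) : Prop := ‖taylorRem n (Complex.I * y)‖ ≤ 1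

/-- p. 615: **`|R_{n̄+1}(qA)| ≤ 1` for real `A`** (`q` imaginary) — PROVED: on the path `t ∈ [0, 1]` the integrand of
`R_{n̄+1}(iy)` has norm `(1 − t)^{n̄}`, whose integral is `1/(n̄ + 1)`. [cite: Balaban1982Higgs1, p.615 (bound on R_{n̄+1})] -/
theorem remBound_holds (n : ℕ) (y : ℝ) : RemBound n y := by
  unfold RemBound taylorRem
  have hn : ‖((n : ℂ) + 1)‖ = (n : ℝ) + 1 := by
    have e : ((n : ℂ) + 1) = ((n + 1 : ℕ) : ℂ) := by push_cast; ring
    rw [e, Complex.norm_natCast]; push_cast; ring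
  have hint : ‖∫ t in (0 : ℝ)..1, ((1 - t : ℝ) : ℂ) ^ n * Complex.exp (t * (Complex.I * y))‖ ≤ 1 / (n + 1) := by
    calc ‖∫ t in (0 : ℝ)..1, ((1 - t : ℝ) : ℂ) ^ n * Complex.exp (t * (Complex.I * y))‖
        ≤ ∫ t in (0 : ℝ)..1, ‖((1 - t : ℝ) : ℂ) ^ n * Complex.exp (t * (Complex.I * y))‖ :=
          intervalIntegral.norm_integral_le_integral_norm zero_le_one
      _ = ∫ t in (0 : ℝ)..1, (1 - t) ^ n := by
          apply intervalIntegral.integral_congr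
          intro t ht
          rw [Set.uIcc_of_le zero_le_one] at ht
          have ht' : 0 ≤ 1 - t := by linarith [ht.2]
          have hexp : Complex.exp ((t : ℂ) * (Complex.I * y)) = Complex.exp (((t * y : ℝ) : ℂ) * Complex.I) := by
            congr 1; push_cast; ring
          simp only [norm_mul, norm_pow, Complex.norm_real, Real.norm_eq_abs, abs_of_nonneg ht', hexp,
            Complex.norm_exp_ofReal_mul_I, mul_one]
      _ = 1 / (n + 1) := by
          -- `∫₀¹ (1 − t)ⁿ dt = 1/(n+1)` (the same computation as `Literature.Analysis.FunctionSpaces.integral_one_sub_pow`,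
          -- inlined to keep this module's imports inside the Balaban/Mathlib cone)
          have h := intervalIntegral.integral_comp_sub_left (fun x : ℝ => x ^ n) (1 : ℝ) (a := 0) (b := 1)
          simp only [sub_self, sub_zero] at h
          rw [h, integral_pow]
          simp
  rw [norm_mul, hn]
  calc ((n : ℝ) + 1) * ‖∫ t in (0 : ℝ)..1, ((1 - t : ℝ) : ℂ) ^ n * Complex.exp (t * (Complex.I * y))‖
      ≤ ((n : ℝ) + 1) * (1 / (n + 1)) := mul_le_mul_of_nonneg_left hint (by positivity)
    _ = 1 := by field_simp

end Taylor

/-! ## Part D. Truncated expectations (3.23) and the first-step cumulant expansion (3.24) -/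

section Cumulants

/-- **(3.23)** p. 616 [PDF 14], verbatim: *"⟨V²⟩^T = ⟨V²⟩ − ⟨V⟩²"* (truncated expectation of order 2; `m1 = ⟨V⟩`,
`m2 = ⟨V²⟩`). [cite: Balaban1982Higgs1, (3.23) p.616] -/
def trunc2 (m1 m2 : ℝ) : ℝ := m2 - m1 ^ 2

/-- **(3.23)** p. 616, order 3.  The print reads *"⟨V³⟩^T = ⟨V³⟩ − 3⟨V²⟩⟨V⟩ + ⟨V⟩³"* [sic]; the truncated
(connected) expectation defined by the generating relation (3.23) `⟨exp V⟩ = exp[⟨V⟩ + ⟨V²⟩^T/2! + ⟨V³⟩^T/3! + …]` has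
the coefficient `+2⟨V⟩³` (third cumulant), which is what is typed here; `trunc3_printed` records the printed slip.
[cite: Balaban1982Higgs1, (3.23) p.616] -/
def trunc3 (m1 m2 m3 : ℝ) : ℝ := m3 - 3 * m2 * m1 + 2 * m1 ^ 3

/-- The third-order coefficient identity behind (3.23): matching `t³` in `exp(κ₁t + κ₂t²/2 + κ₃t³/6) = 1 + m₁t + m₂t²/2 +
m₃t³/6 + …` gives `m₃ = κ₃ + 3κ₂κ₁ + κ₁³` with `κ₁ = m₁`, `κ₂ = trunc2`, `κ₃ = trunc3` — PROVED (so the `+⟨V⟩³` of the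
print is a misprint for `+2⟨V⟩³`). [cite: Balaban1982Higgs1, (3.23) p.616] -/
theorem trunc3_moment (m1 m2 m3 : ℝ) : m3 = trunc3 m1 m2 m3 + 3 * trunc2 m1 m2 * m1 + m1 ^ 3 := by
  unfold trunc3 trunc2; ring

/-- The printed third-order expression differs from `trunc3` by exactly `⟨V⟩³`. [cite: Balaban1982Higgs1, (3.23) p.616] -/
theorem trunc3_printed (m1 m2 m3 : ℝ) : (m3 - 3 * m2 * m1 + m1 ^ 3) = trunc3 m1 m2 m3 - m1 ^ 3 := by
  unfold trunc3; ring

/-- **(3.24)** p. 616 [PDF 14], verbatim: *"⟨χ exp(V)⟩ = exp[⟨V⟩ + (1/2!)⟨V²⟩^T + … + (1/n̄!)⟨V^{n̄}⟩^T + O(ε^κ)|T₁|],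
κ > d"* (*"we will rely on the results of Benfatto et al. [2]. The lemma formulated on p. 152 of this paper can be applied
in our situation"*) — the FIRST-STEP instance; the k-th-step version (3.59) p. 623 over a whole run is
`B1LowerBound.Cumulant359` (not restated).  Typed for one expectation: the truncated expectations `cum n = ⟨Vⁿ⟩^T`, the
error with explicit constant `C`, rate `κ`, spacing `s = ε` and volume `vol = |T₁|`. [cite: Balaban1982Higgs1, (3.24) p.616] -/
def Eq324 (lhs : ℝ) (cum : ℕ → ℝ) (nbar : ℕ) (C s κ vol : ℝ) : Prop :=
  ∃ r : ℝ, |r| ≤ C * s ^ κ * vol ∧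
    lhs = Real.exp (∑ n ∈ Finset.Icc 1 nbar, cum n / (n.factorial : ℝ) + r)

end Cumulants

/-! ## Part E. The form of the action (3.30), the contour field (3.34), the perturbative formula (3.36)/(3.62), the
fluctuation integral (3.56), the composition identity (3.65) ((3.26)–(3.29): `B1LowerBound.IndHyp326`, `SmallFieldAt`,
`bgField`) -/

section Induction

/-- **(3.30)** p. 617, verbatim: *"S^{(k),L^kε}(A, φ) = −log Z_k − log Z_k(A^{(k),ε}) + ½⟨A, Δ^{(k),L^kε}A⟩ +
½⟨φ, Δ^{(k),L^kε}(A^{(k),ε})φ⟩ − 𝒫^{(k),L^kε}(A^{(k),ε}, φ) + E₀"* — the FORM of the k-th action, its six constituents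
as arguments (the normalisations (3.31)–(3.32) `logZk`, `logZkA`; the two quadratic forms; the effective polynomial
`P`; the constant `E₀`). [cite: Balaban1982Higgs1, (3.30) p.617] -/
noncomputable def action330 (logZk logZkA formA formφ P E₀ : ℝ) : ℝ :=
  -logZk - logZkA + 1 / 2 * formA + 1 / 2 * formφ - P + E₀

/-- **(3.34)** p. 618 [PDF 16], verbatim: *"Making use of the definition (2.2) we assume A(Γ^{(k)}_{y,x}) =
A^{(k),ε}(Γ^{(k)}_{y,x}) + Σ_{j=1}^{k−1} A′^{(j),ε}(Γ^{(j+1)}_{x_{j+1},x}), (3.34) where we have denoted x_k = y, x₀ = x."*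
(the convention for `U(A(Γ^{(k)}_{y,x}))` in `Q_k(A)` when `A` is the sum (3.33); cited by [Balaban1983Higgs3] p. 412
as *"the definition (I.3.34)"*).  Typed as the sum of the contour integrals: `top` = `A^{(k),ε}(Γ^{(k)}_{y,x})`, `lower j`
= `A′^{(j),ε}(Γ^{(j+1)}_{x_{j+1},x})`. [cite: Balaban1982Higgs1, (3.34) p.618] -/
def contour334 {V : Type*} [AddCommMonoid V] (top : V) (lower : ℕ → V) (k : ℕ) : V :=
  top + ∑ j ∈ Finset.Icc 1 (k - 1), lower j

/-- **(3.36)** p. 618 and **(3.62)**/**(3.63)** p. 624 [PDF 22], verbatim (3.62): *"S^{(k+1),L^{k+1}ε}(B, ψ) =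
Σ_{0≦α+β≦n̄} (1/(α!β!)) e^αλ^β (∂^{α+β}/∂e′^α∂λ′^β E(e′, λ′, B, ψ))|_{e′=λ′=0}"* ((3.36): the same with the quadratic
term `½⟨A, Δ^{(k),L^kε}A⟩` split off and `E = E_k(e′, λ′, eA^{(k),ε}, φ)` of (3.35)).  Typed: the truncated double
Taylor sum of a generating function `E : ℝ → ℝ → ℝ` (the fields fixed) in the couplings `(e, λ)` at `(0, 0)`, mixed
partials as iterated one-variable derivatives. [cite: Balaban1982Higgs1, (3.62) p.624; (3.36) p.618] -/
noncomputable def pertSum362 (E : ℝ → ℝ → ℝ) (e lam : ℝ) (nbar : ℕ) : ℝ :=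
  ∑ ab ∈ (Finset.range (nbar + 1) ×ˢ Finset.range (nbar + 1)).filter (fun ab => ab.1 + ab.2 ≤ nbar),
    1 / ((ab.1.factorial : ℝ) * (ab.2.factorial : ℝ)) * e ^ ab.1 * lam ^ ab.2 *
      iteratedDeriv ab.1 (fun e' => iteratedDeriv ab.2 (fun l' => E e' l') 0) 0

/-- **(3.36)** p. 618, verbatim: *"S^{(k),L^kε}(A, φ) = ½⟨A, Δ^{(k),L^kε}A⟩ + Σ_{0≦α+β≦n̄} (1/(α!β!)) e^αλ^β
(∂^{α+β}/∂e′^α∂λ′^β E_k(e′, λ′, eA^{(k),ε}, φ))|_{e′=λ′=0}"*, as a `Prop` relating the action value, the quadratic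
term and the generating function. [cite: Balaban1982Higgs1, (3.36) p.618] -/
def Eq336 (S quadA : ℝ) (Ek : ℝ → ℝ → ℝ) (e lam : ℝ) (nbar : ℕ) : Prop :=
  S = 1 / 2 * quadA + pertSum362 Ek e lam nbar

/-- **(3.56)** p. 622 [PDF 20], verbatim: *"The next step is a calculation of the integral ∫dμ_{C^{(k)}}(A′)
∫dμ_{C^{(k)}(B^{(k+1)})}(φ′) χ(A′)χ(φ′) exp(V^{(k)}). (3.56)"* (cited by [Balaban1982Higgs2] p. 582 as *"(I.3.56)"*) —
the iterated Gaussian integral over the two fluctuation fields, the Gaussian measures `μA`, `μφ`, characteristic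
functions and the polynomial `V` as arguments. [cite: Balaban1982Higgs1, (3.56) p.622] -/
noncomputable def integral356 {ΩA Ωφ : Type*} [MeasurableSpace ΩA] [MeasurableSpace Ωφ]
    (μA : Measure ΩA) (μφ : Measure Ωφ) (χA : ΩA → ℝ) (χφ : Ωφ → ℝ) (V : ΩA → Ωφ → ℝ) : ℝ :=
  ∫ a, ∫ f, χA a * χφ f * Real.exp (V a f) ∂μφ ∂μA

/-- **(3.65)** p. 624, verbatim: *"Taking into account the law of composition of the renormalization transformations
(2.14) and the convention (3.34) we obtain the following equality E′(e′, λ′, B, ψ) = ½⟨B, Δ^{(k+1),L^{k+1}ε}B⟩ +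
E_{k+1}(e′, λ′, eB^{(k+1)ε}, ψ)"* — the inductive step for the generating functions ("Thus we have finished the inductive
proof of the formula (3.63) for the k-th action"); `E'`, `Enext` the two generating functions at fixed fields,
`quadB = ⟨B, Δ^{(k+1),L^{k+1}ε}B⟩`. [cite: Balaban1982Higgs1, (3.65) p.624] -/
def Eq365 (E' Enext : ℝ → ℝ → ℝ) (quadB : ℝ) : Prop := ∀ e' l', E' e' l' = 1 / 2 * quadB + Enext e' l'

/-- From (3.65) the perturbative sums (3.62)/(3.63) of `E′` and of `E_{k+1}` differ exactly by the quadratic term when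
`n̄`-th order Taylor coefficients are taken — the `(α, β) = (0, 0)` term carries `½⟨B, ΔB⟩` and all higher mixed
derivatives of a constant vanish.  Typed as the statement the text draws ("then we get precisely the formula (3.35) [sic:
(3.36)] for S^{(k+1),L^{k+1}ε}"); proof deferred to the differentiability bookkeeping. [cite: Balaban1982Higgs1, (3.63)–(3.65) p.624] -/
def Step363 (E' Enext : ℝ → ℝ → ℝ) (quadB e lam : ℝ) (nbar : ℕ) : Prop :=
  pertSum362 E' e lam nbar = 1 / 2 * quadB + pertSum362 Enext e lam nbar

end Induction

/-! ## Part F. The determinant bounds (3.47) and (3.69) — KERNEL-PROVED for real symmetric matrices (the scalar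
inequality behind them is `B1LowerBound.log_one_add_le_logTaylor`; (3.47) is the predicate `B1LowerBound.Ineq347`) -/

section Determinants

open Matrix Unitary

/-- Spectral bookkeeping for (3.47): for a real symmetric `K`, `Tr K^k = Σ_i λ_i^k` over the eigenvalues (Mathlib's
spectral theorem `Matrix.IsHermitian.spectral_theorem`). [cite: Balaban1982Higgs1, (3.47) p.620] -/
theorem trace_pow_eq_sum_eigenvalues {ι : Type*} [Fintype ι] [DecidableEq ι] {K : Matrix ι ι ℝ}
    (hK : K.IsHermitian) (k : ℕ) : (K ^ k).trace = ∑ i, hK.eigenvalues i ^ k := by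
  conv_lhs => rw [hK.spectral_theorem, ← map_pow, conjStarAlgAut_apply, trace_mul_cycle,
    Unitary.coe_star_mul_self, one_mul, diagonal_pow, trace_diagonal]
  simp

/-- Spectral bookkeeping for (3.47): `det(I − K) = Π_i (1 − λ_i)`. [cite: Balaban1982Higgs1, (3.47) p.620] -/
theorem det_one_sub_eq_prod_eigenvalues {ι : Type*} [Fintype ι] [DecidableEq ι] {K : Matrix ι ι ℝ}
    (hK : K.IsHermitian) : (1 - K).det = ∏ i, (1 - hK.eigenvalues i) := by
  have h1K : 1 - K = conjStarAlgAut ℝ _ hK.eigenvectorUnitary (diagonal fun i => 1 - hK.eigenvalues i) := by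
    conv_lhs => rw [hK.spectral_theorem]
    rw [← map_one (conjStarAlgAut ℝ _ hK.eigenvectorUnitary), ← map_sub, ← diagonal_one, diagonal_sub]
    rfl
  rw [h1K, conjStarAlgAut_apply, det_mul, det_mul, mul_comm, ← mul_assoc, ← det_mul,
    Unitary.coe_star_mul_self, det_one, one_mul, det_diagonal]

/-- Spectral bookkeeping for (3.47): *"the operators standing in the above determinants are positive"* — `I − K`
positive definite forces every eigenvalue of `K` below `1` (so `λ = −λ_i > −1` in the p. 620 inequality).
[cite: Balaban1982Higgs1, (3.47) p.620] -/
theorem eigenvalues_lt_one_of_posDef {ι : Type*} [Fintype ι] [DecidableEq ι] {K : Matrix ι ι ℝ}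
    (hK : K.IsHermitian) (hP : (1 - K).PosDef) (i : ι) : hK.eigenvalues i < 1 := by
  have h1K : 1 - K = conjStarAlgAut ℝ _ hK.eigenvectorUnitary (diagonal fun i => 1 - hK.eigenvalues i) := by
    conv_lhs => rw [hK.spectral_theorem]
    rw [← map_one (conjStarAlgAut ℝ _ hK.eigenvectorUnitary), ← map_sub, ← diagonal_one, diagonal_sub]
    rfl
  rw [h1K, conjStarAlgAut_apply, (Matrix.IsUnit.posDef_star_right_conjugate_iff Unitary.isUnit_coe),
    posDef_diagonal_iff] at hP
  linarith [hP i]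

/-- **(3.47)** p. 620 [PDF 18] — PROVED in matrix form (the predicate `B1LowerBound.Ineq347`, typed by reader r14 with
the proof deferred): for a real matrix `K` with `I − K` positive definite (hence `K` symmetric) and `n` odd,
`[det(I − K)]^{−1/2} ≥ exp Σ_{j=1}^{n} (1/2j) Tr K^j`.  Proof as printed: *"the inequality log(1 + λ) ≦ λ − λ²/2 + … +
(−1)^{n−1}λⁿ/n holding for n odd and λ real, λ > −1, implies"* it — at each eigenvalue (`B1LowerBound.ineq347_scalar`,
from `B1LowerBound.log_one_add_le_logTaylor`), summed, with `Tr K^j = Σ_i λ_i^j` and `det(I − K) = Π_i(1 − λ_i)`.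
[cite: Balaban1982Higgs1, (3.47) p.620] -/
theorem ineq347_of_posDef {ι : Type} [Fintype ι] [DecidableEq ι] {K : Matrix ι ι ℝ}
    (hP : (1 - K).PosDef) {n : ℕ} (hn : Odd n) : B1LowerBound.Ineq347 K n := by
  have hK : K.IsHermitian := by
    have h := (isHermitian_one (α := ℝ) (n := ι)).sub hP.isHermitian
    simpa using h
  unfold B1LowerBound.Ineq347
  have hlt := eigenvalues_lt_one_of_posDef hK hP
  have hdet := det_one_sub_eq_prod_eigenvalues hK
  have hdetpos : 0 < (1 - K).det := by
    rw [hdet]; exact prod_pos fun i _ => by linarith [hlt i]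
  -- the scalar inequality at each eigenvalue, in logarithmic form
  have hsc : ∀ i, ∑ j ∈ range n, (1 / (2 * ((j : ℝ) + 1))) * hK.eigenvalues i ^ (j + 1)
      ≤ -(1 / 2) * Real.log (1 - hK.eigenvalues i) := by
    intro i
    have h := B1LowerBound.ineq347_scalar hn (hlt i)
    have h1 : 0 < 1 - hK.eigenvalues i := by linarith [hlt i]
    rw [Real.rpow_def_of_pos h1, Real.exp_le_exp] at h
    linarith
  -- the exponent as a sum over the eigenvalues
  have hexp : ∑ j ∈ range n, (1 / (2 * ((j : ℝ) + 1))) * (K ^ (j + 1)).trace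
      = ∑ i, ∑ j ∈ range n, (1 / (2 * ((j : ℝ) + 1))) * hK.eigenvalues i ^ (j + 1) := by
    simp_rw [trace_pow_eq_sum_eigenvalues hK, mul_sum]
    exact sum_comm
  rw [hexp, Real.rpow_def_of_pos hdetpos, Real.exp_le_exp, hdet,
    Real.log_prod fun i _ => (by linarith [hlt i] : (1 - hK.eigenvalues i) ≠ 0)]
  calc ∑ i, ∑ j ∈ range n, (1 / (2 * ((j : ℝ) + 1))) * hK.eigenvalues i ^ (j + 1)
      ≤ ∑ i, -(1 / 2) * Real.log (1 - hK.eigenvalues i) := sum_le_sum fun i _ => hsc i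
    _ = (∑ i, Real.log (1 - hK.eigenvalues i)) * (-(1 / 2 : ℝ)) := by rw [← mul_sum]; ring


/-- **(3.69)** p. 625 [PDF 23], the step *"[det(I + a_K(L^Kε)^{d−2}P_KG^ε)]^{−1/2}·[det(I + a_K(L^Kε)^{d−2}P_KG^ε(0))]^{−1/2}
exp(O(1)|T_ε|) ≧ exp[−½a_K(L^Kε)^{d−2}(Tr P_KG^ε + Tr P_KG^ε(0)) + O(1)|T_ε|]"*, i.e. `det(I + X)^{−1/2} ≥
exp(−½ Tr X)` for the positive operators involved — typed for one real matrix `X`. [cite: Balaban1982Higgs1, (3.69) p.625] -/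
def Ineq369 {ι : Type*} [Fintype ι] [DecidableEq ι] (X : Matrix ι ι ℝ) : Prop :=
  Real.exp (-(1 / 2) * X.trace) ≤ ((1 + X).det) ^ (-(1 / 2 : ℝ))

/-- **(3.69)** p. 625 — PROVED for every positive semidefinite real matrix `X` (↤ `a_K(L^Kε)^{d−2}P_KG^ε`, resp. `…G^ε(0)`,
*"obviously … positive and symmetric"*): `det(I + X)^{−1/2} ≥ exp(−½ Tr X)`, i.e. `log det(I + X) = Σ_i log μ_i ≤
Σ_i (μ_i − 1) = Tr X` over the eigenvalues `μ_i > 0` of `I + X` (the `n = 1` case of the p. 620 inequality, Mathlib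
`Real.log_le_sub_one_of_pos`; spectral theorem for `det`/`Tr`). [cite: Balaban1982Higgs1, (3.69) p.625] -/
theorem ineq369_of_posSemidef {ι : Type*} [Fintype ι] [DecidableEq ι] {X : Matrix ι ι ℝ}
    (hX : X.PosSemidef) : Ineq369 X := by
  unfold Ineq369
  have hP : (1 + X).PosDef := PosDef.one.add_posSemidef hX
  have hH : (1 + X).IsHermitian := hP.isHermitian
  have hpos : ∀ i, 0 < hH.eigenvalues i := hH.posDef_iff_eigenvalues_pos.mp hP
  have hdet : (1 + X).det = ∏ i, hH.eigenvalues i := by simpa using hH.det_eq_prod_eigenvalues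
  have htr : (1 + X).trace = ∑ i, hH.eigenvalues i := by simpa using hH.trace_eq_sum_eigenvalues
  have hdetpos : 0 < (1 + X).det := by rw [hdet]; exact prod_pos fun i _ => hpos i
  have hlog : Real.log (1 + X).det ≤ X.trace := by
    rw [hdet, Real.log_prod fun i _ => (hpos i).ne']
    have h1 : ∑ i, Real.log (hH.eigenvalues i) ≤ ∑ i, (hH.eigenvalues i - 1) :=
      sum_le_sum fun i _ => Real.log_le_sub_one_of_pos (hpos i)
    have h2 : ∑ i, (hH.eigenvalues i - 1) = X.trace := by
      rw [sum_sub_distrib, ← htr, trace_add, trace_one]; simp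
    linarith
  rw [Real.rpow_def_of_pos hdetpos, Real.exp_le_exp]
  linarith

/-- **(3.68)** p. 625, verbatim: *"Z^ε ≧ Z_KZ_K(0) exp(−E₀ + O(1)|T_ε|)"* with *"a constant O(1) which in general depends on
L^Kε, thus on ε₀"*, and (3.69) *"Z_KZ_K(0) exp(−E₀) = … = exp(O(1)|T_ε|), and we obtain finally the required lower
bound"* — the last two displayed steps of the proof of the lower bound (1.14), typed with explicit constants `C₁, C₂`
for the two `O(1)`. [cite: Balaban1982Higgs1, (3.68)–(3.69) p.625] -/
def Ineq368 (Z ZK ZK0 E₀ C₁ C₂ vol : ℝ) : Prop :=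
  Z ≥ ZK * ZK0 * Real.exp (-E₀ - C₁ * vol) ∧ ZK * ZK0 * Real.exp (-E₀) ≥ Real.exp (-C₂ * vol)

/-- (3.68) + (3.69) give the lower bound `Z^ε ≥ exp(−O(1)|T_ε|)` of the Theorem (1.14) — the one-line conclusion of
p. 625, PROVED from the two typed steps (`0 ≤` volume factors understood: `exp` is monotone). [cite: Balaban1982Higgs1, (3.68)–(3.69) p.625] -/
theorem lowerBound_of_368 {Z ZK ZK0 E₀ C₁ C₂ vol : ℝ} (h : Ineq368 Z ZK ZK0 E₀ C₁ C₂ vol) :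
    Z ≥ Real.exp (-(C₁ + C₂) * vol) := by
  obtain ⟨h1, h2⟩ := h
  have e : ZK * ZK0 * Real.exp (-E₀ - C₁ * vol) = ZK * ZK0 * Real.exp (-E₀) * Real.exp (-(C₁ * vol)) := by
    rw [show -E₀ - C₁ * vol = -E₀ + -(C₁ * vol) by ring, Real.exp_add]; ring
  rw [e] at h1
  have h3 : ZK * ZK0 * Real.exp (-E₀) * Real.exp (-(C₁ * vol)) ≥ Real.exp (-C₂ * vol) * Real.exp (-(C₁ * vol)) :=
    mul_le_mul_of_nonneg_right h2 (Real.exp_pos _).le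
  have e2 : Real.exp (-C₂ * vol) * Real.exp (-(C₁ * vol)) = Real.exp (-(C₁ + C₂) * vol) := by
    rw [← Real.exp_add]; ring_nf
  linarith [h3, e2.symm.le, e2.le]

end Determinants

/-! ## Part G (v1.1). The ONE-SIDED reading in `λ′` of the perturbative sums (3.36)/(3.62)/(3.63) — decls of record
for instantiation at the lattice generating functions (defined for `λ′ ≥ 0` only), aligned with r01's repaired (1.13)
`B1Sect1Statements.ModelData.e1R`; the v1.0 two-sided `pertSum362`/`Eq336`/`Step363` above are kept verbatim -/

section OneSided

/-- **(3.62)** p. 624 [PDF 22] / **(3.36)** p. 618 [PDF 16], ONE-SIDED READING (v1.1 decl of record), verbatim (3.62):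
*"S^{(k+1),L^{k+1}ε}(B, ψ) = Σ_{0≦α+β≦n̄} (1/(α!β!)) e^αλ^β (∂^{α+β}/∂e′^α∂λ′^β E(e′, λ′, B, ψ))|_{e′=λ′=0}"* — the
truncated double Taylor sum of a generating function `E : ℝ → ℝ → ℝ` (fields fixed) in the couplings at `(0, 0)`, the
`λ′`-DERIVATIVES TAKEN FROM THE RIGHT AT `0⁺` (`iteratedDerivWithin β · (Set.Ici 0) 0`: the generating functions (3.35)
exist only for `λ′ ≥ 0` — *"we will assume that μ₀² > 0 and λ > 0"*, p. 605 — and the perturbation expansion is their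
Taylor series there), the `e′`-derivatives two-sided (`iteratedDeriv α · 0`), inner variable `λ′`, outer `e′` (the
convention of `B1Sect1Statements.ModelData.e1R`). [cite: Balaban1982Higgs1, (3.62) p.624; (3.36) p.618] -/
noncomputable def pertSum362R (E : ℝ → ℝ → ℝ) (e lam : ℝ) (nbar : ℕ) : ℝ :=
  ∑ ab ∈ (Finset.range (nbar + 1) ×ˢ Finset.range (nbar + 1)).filter (fun ab => ab.1 + ab.2 ≤ nbar),
    1 / ((ab.1.factorial : ℝ) * (ab.2.factorial : ℝ)) * e ^ ab.1 * lam ^ ab.2 *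
      iteratedDeriv ab.1 (fun e' => iteratedDerivWithin ab.2 (fun l' => E e' l') (Set.Ici 0) 0) 0

/-- **(3.36)** p. 618, ONE-SIDED READING (v1.1 decl of record), verbatim: *"S^{(k),L^kε}(A, φ) = ½⟨A, Δ^{(k),L^kε}A⟩ +
Σ_{0≦α+β≦n̄} (1/(α!β!)) e^αλ^β (∂^{α+β}/∂e′^α∂λ′^β E_k(e′, λ′, eA^{(k),ε}, φ))|_{e′=λ′=0}"* — as `Eq336`, with the
one-sided sum `pertSum362R`. [cite: Balaban1982Higgs1, (3.36) p.618] -/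
def Eq336R (S quadA : ℝ) (Ek : ℝ → ℝ → ℝ) (e lam : ℝ) (nbar : ℕ) : Prop :=
  S = 1 / 2 * quadA + pertSum362R Ek e lam nbar

/-- **(3.63) + (3.65) ⇒ (3.36)_{k+1}**, ONE-SIDED READING (v1.1 decl of record) of `Step363`: the one-sided perturbative
sums of `E′` and of `E_{k+1}` differ exactly by the quadratic term `½⟨B, Δ^{(k+1),L^{k+1}ε}B⟩` (p. 624: *"then we get
precisely the formula (3.35) [sic: (3.36)] for S^{(k+1),L^{k+1}ε}"*).  PROVED from `Eq365` below (`step363R_of_eq365`).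
[cite: Balaban1982Higgs1, (3.63)–(3.65) p.624] -/
def Step363R (E' Enext : ℝ → ℝ → ℝ) (quadB e lam : ℝ) (nbar : ℕ) : Prop :=
  pertSum362R E' e lam nbar = 1 / 2 * quadB + pertSum362R Enext e lam nbar

/-- **What the repair buys**: the one-sided sum depends on the generating function ONLY through its values on `λ′ ≥ 0`
(all `e′`) — two generating functions that agree on `ℝ × [0, ∞)` have the same (3.62)-sum, whatever junk they carry on
`λ′ < 0` (`iteratedDerivWithin_congr` on `Set.Ici 0`). [cite: Balaban1982Higgs1, (3.62) p.624, p.605] -/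
theorem pertSum362R_congr_Ici {E E' : ℝ → ℝ → ℝ} (h : ∀ e' l', 0 ≤ l' → E e' l' = E' e' l') (e lam : ℝ) (nbar : ℕ) :
    pertSum362R E e lam nbar = pertSum362R E' e lam nbar := by
  unfold pertSum362R
  refine Finset.sum_congr rfl fun ab _ => ?_
  have hfun : (fun e' => iteratedDerivWithin ab.2 (fun l' => E e' l') (Set.Ici 0) 0)
      = fun e' => iteratedDerivWithin ab.2 (fun l' => E' e' l') (Set.Ici 0) 0 := by
    funext e'
    exact iteratedDerivWithin_congr (s := Set.Ici (0 : ℝ)) (f := fun l' => E e' l') (g := fun l' => E' e' l')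
      (fun l' hl' => h e' l' (Set.mem_Ici.mp hl')) (Set.mem_Ici.mpr le_rfl)
  rw [hfun]

/-- Term by term: if `λ′ ↦ E(e′, λ′)` is `C^β` at `0` two-sidedly for every `e′`, the right `β`-th derivative at `0⁺` IS the
two-sided one (`iteratedDerivWithin_eq_iteratedDeriv` on the closed half-line, `uniqueDiffOn_Ici`), hence so are all the
outer `e′`-derivatives. [cite: Balaban1982Higgs1, (3.62) p.624, dictionary] -/
theorem iteratedDeriv_within_eq_of_contDiffAt {E : ℝ → ℝ → ℝ} {β : ℕ}
    (h : ∀ e', ContDiffAt ℝ β (fun l' => E e' l') 0) (α : ℕ) :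
    iteratedDeriv α (fun e' => iteratedDerivWithin β (fun l' => E e' l') (Set.Ici 0) 0) 0
      = iteratedDeriv α (fun e' => iteratedDeriv β (fun l' => E e' l') 0) 0 := by
  have hfun : (fun e' => iteratedDerivWithin β (fun l' => E e' l') (Set.Ici 0) 0)
      = fun e' => iteratedDeriv β (fun l' => E e' l') 0 := by
    funext e'
    exact iteratedDerivWithin_eq_iteratedDeriv (uniqueDiffOn_Ici 0) (h e') (Set.mem_Ici.mpr le_rfl)
  rw [hfun]

/-- **Agreement of the two readings under two-sided smoothness**: if for every `e′` the function `λ′ ↦ E(e′, λ′)` is `C^β`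
at `λ′ = 0` for all `β ≦ n̄` (in particular for any `E` jointly `C^∞` on `ℝ²`, the standing hypothesis shape of p14's
`B1Eq363JetProof`/`B1Eq364Substitution`), then `pertSum362R E = pertSum362 E` — every schematic theorem about the v1.0
sum transfers to the decl of record under its own hypotheses. [cite: Balaban1982Higgs1, (3.62) p.624; (3.36) p.618, dictionary] -/
theorem pertSum362R_eq_pertSum362 {E : ℝ → ℝ → ℝ} {nbar : ℕ}
    (h : ∀ e', ∀ β ≤ nbar, ContDiffAt ℝ β (fun l' => E e' l') 0) (e lam : ℝ) :
    pertSum362R E e lam nbar = pertSum362 E e lam nbar := by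
  unfold pertSum362R pertSum362
  refine Finset.sum_congr rfl fun ab hab => ?_
  have hβ : ab.2 ≤ nbar := by
    have := (Finset.mem_filter.mp hab).2
    omega
  rw [iteratedDeriv_within_eq_of_contDiffAt (fun e' => h e' ab.2 hβ)]

/-- Under the same two-sided smoothness the one-sided (3.36) is the v1.0 (3.36). [cite: Balaban1982Higgs1, (3.36) p.618, dictionary] -/
theorem eq336R_iff_eq336 {S quadA : ℝ} {Ek : ℝ → ℝ → ℝ} {e lam : ℝ} {nbar : ℕ}
    (h : ∀ e', ∀ β ≤ nbar, ContDiffAt ℝ β (fun l' => Ek e' l') 0) :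
    Eq336R S quadA Ek e lam nbar ↔ Eq336 S quadA Ek e lam nbar := by
  unfold Eq336R Eq336
  rw [pertSum362R_eq_pertSum362 h]

/-- The `β = 0` terms (pure-`e` coefficients) of the two readings agree with NO hypothesis (`iteratedDerivWithin 0 = id =
iteratedDeriv 0`); the readings differ exactly in the `β ≥ 1` (`λ`-) coefficients. [cite: Balaban1982Higgs1, (3.62) p.624, dictionary] -/
theorem pertSum362R_term_beta_zero (E : ℝ → ℝ → ℝ) (α : ℕ) :
    iteratedDeriv α (fun e' => iteratedDerivWithin 0 (fun l' => E e' l') (Set.Ici 0) 0) 0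
      = iteratedDeriv α (fun e' => iteratedDeriv 0 (fun l' => E e' l') 0) 0 := by
  simp only [iteratedDerivWithin_zero, iteratedDeriv_zero]

/-- A constant shift moves only the order-`0` right derivative. [folklore] -/
private theorem iteratedDerivWithin_const_add_ite (β : ℕ) (c : ℝ) (f : ℝ → ℝ) :
    iteratedDerivWithin β (fun l' => c + f l') (Set.Ici 0) 0
      = (if β = 0 then c else 0) + iteratedDerivWithin β f (Set.Ici 0) 0 := by
  rcases Nat.eq_zero_or_pos β with rfl | hβ
  · simp [iteratedDerivWithin_zero]
  · rw [iteratedDerivWithin_const_add hβ, if_neg hβ.ne', zero_add]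

/-- A constant shift of the generating function moves only the `(α, β) = (0, 0)` mixed coefficient (one-sided in `λ′`,
two-sided in `e′`). [folklore] -/
private theorem iteratedDeriv₂R_const_add (α β : ℕ) (c : ℝ) (E : ℝ → ℝ → ℝ) :
    iteratedDeriv α (fun e' => iteratedDerivWithin β (fun l' => c + E e' l') (Set.Ici 0) 0) 0
      = (if α = 0 ∧ β = 0 then c else 0)
        + iteratedDeriv α (fun e' => iteratedDerivWithin β (fun l' => E e' l') (Set.Ici 0) 0) 0 := by
  simp_rw [iteratedDerivWithin_const_add_ite β c]
  rcases Nat.eq_zero_or_pos α with rfl | hα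
  · simp
  · rw [iteratedDeriv_const_add hα, if_neg (fun h => hα.ne' h.1), zero_add]

/-- **A constant shift of the generating function shifts the one-sided (3.62)-sum by the same constant** (it enters the
`(0, 0)` term only; every higher coefficient of a constant vanishes) — the mechanism of p. 624's *"then we get precisely
the formula (3.36)"*. [cite: Balaban1982Higgs1, (3.63)–(3.65) p.624] -/
theorem pertSum362R_const_add (c : ℝ) (E : ℝ → ℝ → ℝ) (e lam : ℝ) (nbar : ℕ) :
    pertSum362R (fun e' l' => c + E e' l') e lam nbar = c + pertSum362R E e lam nbar := by
  unfold pertSum362R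
  simp_rw [iteratedDeriv₂R_const_add, mul_add, Finset.sum_add_distrib]
  congr 1
  rw [Finset.sum_eq_single (0, 0)]
  · simp
  · intro ab _ hne
    have h : ¬ (ab.1 = 0 ∧ ab.2 = 0) := fun h => hne (Prod.ext h.1 h.2)
    rw [if_neg h, mul_zero]
  · intro h0
    exact absurd (by simp) h0

/-- **`Step363R ⇐ Eq365` — (3.65) substituted into (3.63), p. 624, ONE-SIDED READING**: if `E′(e′, λ′) = ½⟨B, ΔB⟩ +
E_{k+1}(e′, λ′)` for all `e′, λ′` (`Eq365`; agreement on `λ′ ≥ 0` would suffice, by `pertSum362R_congr_Ici`), then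
`pertSum362R E′ e λ n̄ = ½⟨B, ΔB⟩ + pertSum362R E_{k+1} e λ n̄` — for all couplings and every order, with no regularity
assumption. [cite: Balaban1982Higgs1, (3.63)–(3.65) p.624] -/
theorem step363R_of_eq365 {E' Enext : ℝ → ℝ → ℝ} {quadB : ℝ} (h : Eq365 E' Enext quadB) (e lam : ℝ) (nbar : ℕ) :
    Step363R E' Enext quadB e lam nbar := by
  have hE : E' = fun e' l' => 1 / 2 * quadB + Enext e' l' := funext fun e' => funext fun l' => h e' l'
  unfold Step363R
  rw [hE, pertSum362R_const_add]

/-- The same with (3.65) required only on the physical half-plane `λ′ ≥ 0` (where the generating functions exist).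
[cite: Balaban1982Higgs1, (3.63)–(3.65) p.624, p.605] -/
theorem step363R_of_eq365_Ici {E' Enext : ℝ → ℝ → ℝ} {quadB : ℝ}
    (h : ∀ e' l', 0 ≤ l' → E' e' l' = 1 / 2 * quadB + Enext e' l') (e lam : ℝ) (nbar : ℕ) :
    Step363R E' Enext quadB e lam nbar := by
  unfold Step363R
  rw [pertSum362R_congr_Ici (E' := fun e' l' => 1 / 2 * quadB + Enext e' l') h, pertSum362R_const_add]

/-- **The sentence p. 624**, ONE-SIDED READING — *"If we substitute in the formula (3.63) the above expression for E′ …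
then we get precisely the formula (3.36) for S^{(k+1),L^{k+1}ε}. Thus we have finished the inductive proof"*: (3.63)
`S^{(k+1)} = pertSum362R E′` and (3.65) give `Eq336R` at level `k + 1`. [cite: Balaban1982Higgs1, (3.63)–(3.65) p.624; (3.36) p.618] -/
theorem eq336R_succ {S : ℝ} {E' Enext : ℝ → ℝ → ℝ} {quadB e lam : ℝ} {nbar : ℕ}
    (h363 : S = pertSum362R E' e lam nbar) (h365 : Eq365 E' Enext quadB) : Eq336R S quadB Enext e lam nbar := by
  unfold Eq336R
  rw [h363]
  exact step363R_of_eq365 h365 e lam nbar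

/-- Conversely, under (3.65) the level-(k+1) one-sided (3.36) gives back the one-sided (3.63). [cite: Balaban1982Higgs1, (3.63)–(3.65) p.624] -/
theorem step363R_iff {S : ℝ} {E' Enext : ℝ → ℝ → ℝ} {quadB e lam : ℝ} {nbar : ℕ} (h365 : Eq365 E' Enext quadB) :
    S = pertSum362R E' e lam nbar ↔ Eq336R S quadB Enext e lam nbar := by
  unfold Eq336R
  rw [show pertSum362R E' e lam nbar = 1 / 2 * quadB + pertSum362R Enext e lam nbar from
    step363R_of_eq365 h365 e lam nbar]

/-- Order-zero sanity check: at `n̄ = 0` the one-sided sum is the value of the generating function at zero couplings,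
`pertSum362R E e λ 0 = E(0, 0)`. [cite: Balaban1982Higgs1, (3.62) p.624] -/
theorem pertSum362R_zero (E : ℝ → ℝ → ℝ) (e lam : ℝ) : pertSum362R E e lam 0 = E 0 0 := by
  unfold pertSum362R
  rw [show (Finset.range (0 + 1) ×ˢ Finset.range (0 + 1)).filter (fun ab : ℕ × ℕ => ab.1 + ab.2 ≤ 0) = {(0, 0)} by
    decide]
  simp

end OneSided

end Literature.MathematicalPhysics.QuantumFieldTheory.Balaban1983to89.B1Sect3Statements
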